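import Mathlib

/-!
# ValiantsHypothesis / LacunarySymmetroid — crux `MatrixDescartes` (stmt-ValiantsHypothesis-18050),
# line `Cruxes/MatrixDescartes/Lines/lorentzian_shadow.lean`, FIRST RUNG `stub_shadowPath`

The line's first rung `stub_shadowPath : ShadowPathBound` (the **M-convex shadow path bound**, pure
discrete convex analysis) is PROVED here for ALL formats `(m, K)`.  The statement below is the
line's Prop `ShadowPathBound` with its local vocabulary (`layer`, `exch`, `IsMConvexOn`, `wt`,
`IsShadowVertex`, `shadowVertexCount`) UNFOLDED to Mathlib terms (the line file lives under
`Cruxes/` and carries `sorry`s, so it cannot be imported); the two statements agree definitionally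
(the `Finset.filter` carries the same classical instance), so the line closes its stub by
`exact shadowPathBound` (checked).  The per-format "cheapest falsifiers" `(3,4), (4,4), (2,6)` of
the line card quantify over all `ν : (Fin K → ℕ) → ℚ` and all weights, so they are NOT decidable
propositions; they follow by specialisation.

**Statement.**  `D ⊆ Δ(m,K) = {α : Fin K → ℕ | Σ α = m}`, `ν : D → ℚ` M-convex (Murota's exchange
axiom: for `α, β ∈ D` and `i` with `β i < α i` there is `j` with `α j < β j`, both exchanges
`α - eᵢ + eⱼ`, `β - eⱼ + eᵢ` in `D`, and `ν(α - eᵢ + eⱼ) + ν(β - eⱼ + eᵢ) ≤ ν α + ν β`), weights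
`e : Fin K → ℕ` injective.  A SHADOW VERTEX is an `α ∈ D` that is the strict unique minimiser of
`ν β + u·⟨e, β⟩` over `D` for some slope `u ∈ ℚ` (a vertex of the lower hull of `{(⟨e,β⟩, ν β)}` =
of the tropical `x`-Newton polygon).  Then there are at most `m (K - 1) + 1` shadow vertices.

**Proof.**  `w β = ⟨e, β⟩`, `g_u = ν + u·w`, RANK POTENTIAL `Φ β = Σ_i r_i β_i`,
`r_i = #{k | e k < e i}` (`Φ ≤ (K-1) m` on `Δ(m,K)`; `e i < e j → r i < r j`).
(1) `argmin_exchange`: for a lower bound `c` of `g_u` on `D`, `{β ∈ D | g_u β ≤ c}` is an M-convex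
SET (exchanges preserve `w α + w β`).  (2) `potential_add_dist_le` (gross substitutes, potential
form): in an exchange-closed set, a maximal-weight `α` satisfies `Φ β + d(β,α) ≤ Φ α` for all `β`,
`d(β,α) = Σ (β_i ∸ α_i)` — exchange at `i` with `α i < β i` returns `j` with `α - eⱼ + eᵢ` in the
set, so `e i < e j` by maximality + injectivity, `r i < r j`, and `β - eᵢ + eⱼ` is closer to `α`
with larger `Φ`.  (3) `potential_lt_of_rightEnd`: if `α` is a RIGHT END at slope `u` (minimiser of
`g_u` of maximal weight among minimisers) and `α'` minimises some `g_{u'}` with `w α' < w α`, then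
`Φ α' < Φ α` — at the tie slope `u* ∈ [u, u']` either both minimise `g_{u*}` (apply (2)), or a
maximal-weight minimiser `γ` of `g_{u*}` is a right end with `w α' < w γ < w α`: strong induction
on the weight gap.  (4) Shadow vertices are right ends with pairwise distinct weights, so `Φ` is
injective on them with values in `{0, …, m (K-1)}`.

Sources: exchange axiom and minimiser sets, K. Murota, *Discrete Convex Analysis* (SIAM 2003) §6.1;
the monotonicity in (2) is the gross-substitutes property of M♮-concave valuations (Kelso–Crawford
1982, Fujishige–Yang 2003, Murota 2003 ch. 11), proved here directly from the exchange axiom.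
Numerics of record (ideator val-idea-1 I1, critic val-idea-crit-2): bound attained at
`(2,3),(3,3),(4,3),(8,3),(2,4),(3,4),(4,4),(2,5)`, never exceeded.

Honest framing: an M-sized FIRST RUNG of a registered line of the V1 crux, INSTRUMENT / RECORD tier:
it bounds VALUATION classes (the tropical skeleton), not archimedean cores, and is NOT in the cone
of the line's `MatrixDescartes_of` (which consumes the law `LorentzianDescartes` and stubs 2–5).
The crux `LacunarySymmetroid.MatrixDescartes`, Conjecture B (`KPlusLogSqLaw`) and rung V1 do NOT
move; `VP ≠ VNP` is NOT proved and nothing here is progress on it.  No definitions, no named facts.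
-/

-- `Summit.ValiantsHypothesis.ValiantsHypothesis.…` is the tree's mandated single-conjunct layout
-- (Sub = Summit), so the duplicated namespace component is intended.
set_option linter.dupNamespace false
set_option autoImplicit false

namespace Summit.ValiantsHypothesis.ValiantsHypothesis.Theorems.LacunarySymmetroidMatrixDescartes

open Finset
open scoped BigOperators

namespace ShadowPath

variable {K : ℕ}

/-! ### Exchange arithmetic on `Fin K → ℕ` -/

/-- Pointwise value of the exchange `α - eᵢ + eⱼ` (truncated subtraction). -/
theorem exch_apply (α : Fin K → ℕ) (i j k : Fin K) :
    (α - Pi.single i 1 + Pi.single j 1 : Fin K → ℕ) k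
      = α k - (if k = i then 1 else 0) + (if k = j then 1 else 0) := by
  simp [Pi.single_apply]

/-- `Σ_k f_k (β + eⱼ)_k = Σ_k f_k β_k + f_j`. -/
theorem sum_mul_add_single (f β : Fin K → ℕ) (j : Fin K) :
    ∑ k, f k * (β + Pi.single j 1 : Fin K → ℕ) k = ∑ k, f k * β k + f j := by
  simp [Pi.single_apply, mul_add, Finset.sum_add_distrib]

/-- `(α - eᵢ) + eᵢ = α` when `α i ≥ 1`. -/
theorem sub_single_add_single (α : Fin K → ℕ) (i : Fin K) (hi : 1 ≤ α i) :
    α - Pi.single i 1 + Pi.single i 1 = α := by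
  ext k
  rw [exch_apply]
  by_cases hk : k = i
  · subst hk
    simp only [if_true]
    omega
  · simp [hk]

/-- Linear functionals along an exchange: `Σ_k f_k (α - eᵢ + eⱼ)_k + f_i = Σ_k f_k α_k + f_j`
(valid when `α i ≥ 1`, so that the subtraction is a genuine one). -/
theorem sum_mul_exch (f α : Fin K → ℕ) (i j : Fin K) (hi : 1 ≤ α i) :
    ∑ k, f k * (α - Pi.single i 1 + Pi.single j 1 : Fin K → ℕ) k + f i = ∑ k, f k * α k + f j := by
  rw [sum_mul_add_single]
  conv_rhs => rw [← sub_single_add_single α i hi, sum_mul_add_single]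
  ring

/-- The distance `d(β, α) = Σ_k (β_k ∸ α_k)` drops by exactly one along the exchange `β - eᵢ + eⱼ`
when `α i < β i` and `β j < α j`. -/
theorem dist_exch (α β : Fin K → ℕ) (i j : Fin K) (hi : α i < β i) (hj : β j < α j) :
    ∑ k, ((β - Pi.single i 1 + Pi.single j 1 : Fin K → ℕ) k - α k) + 1 = ∑ k, (β k - α k) := by
  have hij : i ≠ j := by rintro rfl; omega
  have h : ∀ k, ((β - Pi.single i 1 + Pi.single j 1 : Fin K → ℕ) k - α k) + (if k = i then 1 else 0)
      = β k - α k := by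
    intro k
    rw [exch_apply]
    by_cases hki : k = i
    · subst hki; simp only [if_true, if_neg hij]; omega
    by_cases hkj : k = j
    · subst hkj; simp only [if_neg hki, if_true]; omega
    simp [hki, hkj]
  calc ∑ k, ((β - Pi.single i 1 + Pi.single j 1 : Fin K → ℕ) k - α k) + 1
      = ∑ k, (((β - Pi.single i 1 + Pi.single j 1 : Fin K → ℕ) k - α k)
          + (if k = i then 1 else 0)) := by
        rw [Finset.sum_add_distrib]; simp
    _ = ∑ k, (β k - α k) := Finset.sum_congr rfl (fun k _ => h k)

/-! ### Step 2: the rank potential is dominated by the maximal-weight point of an M-convex set -/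

/-- **Gross substitutes, potential form.**  Let `P` be an exchange-closed family (an M-convex SET),
`e` injective weights and `r` any `e`-monotone rank function.  If `α ∈ P` has maximal weight
`⟨e, ·⟩` on `P`, then `Σ r_k β_k + d(β, α) ≤ Σ r_k α_k` for every `β ∈ P` (induction on the distance
`d(β, α) = Σ_k (β_k ∸ α_k) = n`). -/
theorem potential_add_dist_le (P : (Fin K → ℕ) → Prop)
    (hP : ∀ α, P α → ∀ β, P β → ∀ i : Fin K, β i < α i →
      ∃ j : Fin K, α j < β j ∧ P (α - Pi.single i 1 + Pi.single j 1) ∧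
        P (β - Pi.single j 1 + Pi.single i 1))
    (e r : Fin K → ℕ) (he : Function.Injective e) (hr : ∀ i j, e i < e j → r i < r j)
    (α : Fin K → ℕ) (hα : P α) (hmax : ∀ γ, P γ → ∑ k, e k * γ k ≤ ∑ k, e k * α k) :
    ∀ n : ℕ, ∀ β, P β → ∑ k, (β k - α k) = n → ∑ k, r k * β k + n ≤ ∑ k, r k * α k := by
  intro n
  induction n with
  | zero =>
    intro β _hβ hd
    have hle : ∀ k, β k ≤ α k := fun k => by
      have := Finset.sum_eq_zero_iff.mp hd k (Finset.mem_univ k); omega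
    simpa using Finset.sum_le_sum fun k _ => Nat.mul_le_mul_left (r k) (hle k)
  | succ n ih =>
    intro β hβ hd
    obtain ⟨i, hi⟩ : ∃ i, α i < β i := by
      by_contra h
      push Not at h
      have : ∑ k, (β k - α k) = 0 :=
        Finset.sum_eq_zero fun k _ => Nat.sub_eq_zero_of_le (h k)
      omega
    obtain ⟨j, hj, hβ', hα'⟩ := hP β hβ α hα i hi
    have hij : i ≠ j := by rintro rfl; omega
    have hw := hmax _ hα'
    have h1 := sum_mul_exch e α j i (by omega)
    have heij : e i < e j := lt_of_le_of_ne (by omega) fun h => hij (he h)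
    have hrij := hr i j heij
    have h2 := sum_mul_exch r β i j (by omega)
    have hd' := dist_exch α β i j hi hj
    have := ih _ hβ' (by omega)
    omega

/-! ### Step 1: minimiser sets of `ν + u·⟨e, ·⟩` are M-convex sets -/

/-- **Minimisers of an M-convex function plus a linear function form an M-convex set.**  If `ν` is
M-convex on `D` (exchange axiom) and `c` is a lower bound of `g_u = ν + u·⟨e,·⟩` on `D`, then the
family `{β ∈ D | g_u β ≤ c}` is exchange-closed. -/
theorem argmin_exchange (D : Finset (Fin K → ℕ)) (ν : (Fin K → ℕ) → ℚ) (e : Fin K → ℕ)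
    (hν : ∀ α ∈ D, ∀ β ∈ D, ∀ i : Fin K, β i < α i →
      ∃ j : Fin K, α j < β j ∧ α - Pi.single i 1 + Pi.single j 1 ∈ D ∧
        β - Pi.single j 1 + Pi.single i 1 ∈ D ∧
        ν (α - Pi.single i 1 + Pi.single j 1) + ν (β - Pi.single j 1 + Pi.single i 1) ≤ ν α + ν β)
    (u c : ℚ) (hc : ∀ γ ∈ D, c ≤ ν γ + u * ((∑ k, e k * γ k : ℕ) : ℚ)) :
    ∀ α, (α ∈ D ∧ ν α + u * ((∑ k, e k * α k : ℕ) : ℚ) ≤ c) →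
      ∀ β, (β ∈ D ∧ ν β + u * ((∑ k, e k * β k : ℕ) : ℚ) ≤ c) → ∀ i : Fin K, β i < α i →
        ∃ j : Fin K, α j < β j ∧
          (α - Pi.single i 1 + Pi.single j 1 ∈ D ∧
            ν (α - Pi.single i 1 + Pi.single j 1) +
              u * ((∑ k, e k * (α - Pi.single i 1 + Pi.single j 1 : Fin K → ℕ) k : ℕ) : ℚ) ≤ c) ∧
          (β - Pi.single j 1 + Pi.single i 1 ∈ D ∧
            ν (β - Pi.single j 1 + Pi.single i 1) +
              u * ((∑ k, e k * (β - Pi.single j 1 + Pi.single i 1 : Fin K → ℕ) k : ℕ) : ℚ) ≤ c) :=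
  by
  rintro α ⟨hαD, hαc⟩ β ⟨hβD, hβc⟩ i hi
  obtain ⟨j, hj, hα', hβ', hineq⟩ := hν α hαD β hβD i hi
  have h1 := sum_mul_exch e α i j (by omega)
  have h2 := sum_mul_exch e β j i (by omega)
  have h1q : ((∑ k, e k * (α - Pi.single i 1 + Pi.single j 1 : Fin K → ℕ) k : ℕ) : ℚ) + (e i : ℚ)
      = ((∑ k, e k * α k : ℕ) : ℚ) + (e j : ℚ) := by exact_mod_cast h1
  have h2q : ((∑ k, e k * (β - Pi.single j 1 + Pi.single i 1 : Fin K → ℕ) k : ℕ) : ℚ) + (e j : ℚ)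
      = ((∑ k, e k * β k : ℕ) : ℚ) + (e i : ℚ) := by exact_mod_cast h2
  have hsum : u * ((∑ k, e k * (α - Pi.single i 1 + Pi.single j 1 : Fin K → ℕ) k : ℕ) : ℚ)
      + u * ((∑ k, e k * (β - Pi.single j 1 + Pi.single i 1 : Fin K → ℕ) k : ℕ) : ℚ)
      = u * ((∑ k, e k * α k : ℕ) : ℚ) + u * ((∑ k, e k * β k : ℕ) : ℚ) := by
    rw [← mul_add, ← mul_add]
    congr 1
    linarith
  have hc1 := hc _ hα'
  have hc2 := hc _ hβ'
  refine ⟨j, hj, ⟨hα', ?_⟩, ⟨hβ', ?_⟩⟩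
  · linarith
  · linarith

/-! ### Step 3: right ends dominate every hull point of smaller weight -/

/-- **Tie-slope induction.**  `D ⊆ Δ(m,K)`, `ν` M-convex on `D`, `e` injective, `r` an `e`-monotone
rank function.  If `α ∈ D` is a RIGHT END at slope `u` (a minimiser of `g_u = ν + u⟨e,·⟩` on `D` of
maximal weight among the minimisers) and `α' ∈ D` minimises `g_{u'}` on `D` for some `u'`, with
`⟨e, α'⟩ < ⟨e, α⟩`, then `Σ r_k α'_k < Σ r_k α_k` (strong induction on the weight gap `n`). -/
theorem potential_lt_of_rightEnd (D : Finset (Fin K → ℕ)) (ν : (Fin K → ℕ) → ℚ)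
    (e r : Fin K → ℕ) (m : ℕ) (hD : ∀ β ∈ D, ∑ k, β k = m)
    (hν : ∀ α ∈ D, ∀ β ∈ D, ∀ i : Fin K, β i < α i →
      ∃ j : Fin K, α j < β j ∧ α - Pi.single i 1 + Pi.single j 1 ∈ D ∧
        β - Pi.single j 1 + Pi.single i 1 ∈ D ∧
        ν (α - Pi.single i 1 + Pi.single j 1) + ν (β - Pi.single j 1 + Pi.single i 1) ≤ ν α + ν β)
    (he : Function.Injective e) (hr : ∀ i j, e i < e j → r i < r j) :
    ∀ n : ℕ, ∀ α ∈ D, ∀ α' ∈ D, ∀ u u' : ℚ,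
      (∀ γ ∈ D, ν α + u * ((∑ k, e k * α k : ℕ) : ℚ) ≤ ν γ + u * ((∑ k, e k * γ k : ℕ) : ℚ)) →
      (∀ γ ∈ D, ν γ + u * ((∑ k, e k * γ k : ℕ) : ℚ) ≤ ν α + u * ((∑ k, e k * α k : ℕ) : ℚ) →
        ∑ k, e k * γ k ≤ ∑ k, e k * α k) →
      (∀ γ ∈ D, ν α' + u' * ((∑ k, e k * α' k : ℕ) : ℚ) ≤ ν γ + u' * ((∑ k, e k * γ k : ℕ) : ℚ)) →
      ∑ k, e k * α' k < ∑ k, e k * α k → ∑ k, e k * α k - ∑ k, e k * α' k ≤ n →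
        ∑ k, r k * α' k < ∑ k, r k * α k := by
  intro n
  induction n using Nat.strong_induction_on with
  | _ n ih =>
  intro α hαD α' hα'D u u' hαmin hαright hα'min hlt hgap
  -- weights as rationals
  set W : (Fin K → ℕ) → ℚ := fun γ => ((∑ k, e k * γ k : ℕ) : ℚ) with hW
  have hWlt : W α' < W α := by simp only [hW]; exact_mod_cast hlt
  have hWd : 0 < W α - W α' := sub_pos.mpr hWlt
  -- the tie slope
  set us : ℚ := (ν α' - ν α) / (W α - W α') with hus
  have hus_mul : us * (W α - W α') = ν α' - ν α := div_mul_cancel₀ _ (ne_of_gt hWd)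
  have hstar : ν α + us * W α = ν α' + us * W α' := by
    have : us * (W α - W α') = us * W α - us * W α' := mul_sub _ _ _
    linarith
  have hu : u ≤ us := by
    have h := hαmin α' hα'D
    have h' : u * (W α - W α') ≤ us * (W α - W α') := by rw [hus_mul, mul_sub]; linarith
    exact le_of_mul_le_mul_right h' hWd
  have hu' : us ≤ u' := by
    have h := hα'min α hαD
    have h' : us * (W α - W α') ≤ u' * (W α - W α') := by rw [hus_mul, mul_sub]; linarith
    exact le_of_mul_le_mul_right h' hWd
  -- a minimiser of `g_{us}` and the minimum value
  obtain ⟨γ₀, hγ₀D, hγ₀min⟩ :=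
    Finset.exists_min_image D (fun γ => ν γ + us * W γ) ⟨α, hαD⟩
  set c : ℚ := ν γ₀ + us * W γ₀ with hc
  have hcle : ∀ γ ∈ D, c ≤ ν γ + us * W γ := fun γ hγ => hγ₀min γ hγ
  by_cases hcase : ν α + us * W α ≤ c
  · -- Case 1: `α` (hence `α'`) is a minimiser at the tie slope; `α` has maximal weight there.
    have hP := argmin_exchange D ν e hν us c hcle
    have hmax : ∀ γ, (γ ∈ D ∧ ν γ + us * W γ ≤ c) → ∑ k, e k * γ k ≤ ∑ k, e k * α k := by
      rintro γ ⟨hγD, hγc⟩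
      have hγα : ν γ + us * W γ ≤ ν α + us * W α := hγc.trans (hcle α hαD)
      rcases eq_or_lt_of_le hu with heq | hult
      · exact hαright γ hγD (by rw [heq]; exact hγα)  -- `u = us`: right-end property at `u`
      · have h1 := hαmin γ hγD
        have h3 : W γ ≤ W α := le_of_mul_le_mul_left (a := us - u) (by nlinarith) (by linarith)
        simp only [hW] at h3; exact_mod_cast h3
    have hdom := potential_add_dist_le (fun γ => γ ∈ D ∧ ν γ + us * W γ ≤ c) hP e r he hr α
      ⟨hαD, hcase⟩ hmax (∑ k, (α' k - α k)) α' ⟨hα'D, by rw [← hstar]; exact hcase⟩ rfl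
    -- the distance is positive since `α' ≠ α` and both lie on the layer `Σ = m`
    have hd : ∑ k, (α' k - α k) ≠ 0 := fun h0 => by
      have hle : ∀ k, α' k ≤ α k := fun k => by
        have := Finset.sum_eq_zero_iff.mp h0 k (Finset.mem_univ k); omega
      have heq := (Finset.sum_eq_sum_iff_of_le fun k _ => hle k).1 (by rw [hD α' hα'D, hD α hαD])
      have : α' = α := funext fun k => heq k (Finset.mem_univ k)
      subst this
      exact lt_irrefl _ hlt
    omega
  · -- Case 2: a maximal-weight minimiser `γ₁` at the tie slope lies strictly between.
    push Not at hcase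
    set M := D.filter (fun γ => ν γ + us * W γ ≤ c) with hM
    have hMne : M.Nonempty := ⟨γ₀, by simp [hM, hγ₀D, hc]⟩
    obtain ⟨γ₁, hγ₁M, hγ₁max⟩ := Finset.exists_max_image M (fun γ => ∑ k, e k * γ k) hMne
    have hγ₁D : γ₁ ∈ D := (Finset.mem_filter.mp hγ₁M).1
    have hγ₁c : ν γ₁ + us * W γ₁ ≤ c := (Finset.mem_filter.mp hγ₁M).2
    -- `γ₁` is a right end and a minimiser at slope `us`
    have hγ₁min : ∀ δ ∈ D, ν γ₁ + us * W γ₁ ≤ ν δ + us * W δ :=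
      fun δ hδ => hγ₁c.trans (hcle δ hδ)
    have hγ₁right : ∀ δ ∈ D, ν δ + us * W δ ≤ ν γ₁ + us * W γ₁ →
        ∑ k, e k * δ k ≤ ∑ k, e k * γ₁ k :=
      fun δ hδ hle => hγ₁max δ (Finset.mem_filter.mpr ⟨hδ, hle.trans hγ₁c⟩)
    -- weights: `w α' < w γ₁ < w α`
    have h2 : ν γ₁ + us * W γ₁ < ν α + us * W α := lt_of_le_of_lt hγ₁c hcase
    have hlt1 : ∑ k, e k * γ₁ k < ∑ k, e k * α k := by
      have h1 := hαmin γ₁ hγ₁D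
      have h4 : W γ₁ < W α := lt_of_mul_lt_mul_left (a := us - u) (by nlinarith) (by linarith)
      simp only [hW] at h4; exact_mod_cast h4
    have hlt2 : ∑ k, e k * α' k < ∑ k, e k * γ₁ k := by
      have h1 := hα'min γ₁ hγ₁D
      rw [hstar] at h2
      have h4 : W α' < W γ₁ := lt_of_mul_lt_mul_left (a := u' - us) (by nlinarith) (by linarith)
      simp only [hW] at h4; exact_mod_cast h4
    -- two applications of the induction hypothesis
    have hA : ∑ k, r k * γ₁ k < ∑ k, r k * α k :=
      ih (∑ k, e k * α k - ∑ k, e k * γ₁ k) (by omega) α hαD γ₁ hγ₁D u us hαmin hαright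
        hγ₁min hlt1 le_rfl
    have hB : ∑ k, r k * α' k < ∑ k, r k * γ₁ k :=
      ih (∑ k, e k * γ₁ k - ∑ k, e k * α' k) (by omega) γ₁ hγ₁D α' hα'D us u' hγ₁min hγ₁right
        hα'min hlt2 le_rfl
    exact hB.trans hA

/-- A strict unique minimiser of `g_u = ν + u⟨e,·⟩` on `D` is a minimiser and a right end. -/
theorem rightEnd_of_strict (D : Finset (Fin K → ℕ)) (ν : (Fin K → ℕ) → ℚ) (e : Fin K → ℕ)
    (β : Fin K → ℕ) (u : ℚ) (hu : ∀ γ ∈ D, γ ≠ β →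
      ν β + u * ((∑ k, e k * β k : ℕ) : ℚ) < ν γ + u * ((∑ k, e k * γ k : ℕ) : ℚ)) :
    (∀ γ ∈ D, ν β + u * ((∑ k, e k * β k : ℕ) : ℚ) ≤ ν γ + u * ((∑ k, e k * γ k : ℕ) : ℚ)) ∧
    (∀ γ ∈ D, ν γ + u * ((∑ k, e k * γ k : ℕ) : ℚ) ≤ ν β + u * ((∑ k, e k * β k : ℕ) : ℚ) →
      ∑ k, e k * γ k ≤ ∑ k, e k * β k) := by
  refine ⟨fun γ hγ => ?_, fun γ hγ hle => ?_⟩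
  · by_cases h : γ = β
    · rw [h]
    · exact le_of_lt (hu γ hγ h)
  · by_cases h : γ = β
    · rw [h]
    · exact absurd (hu γ hγ h) (not_lt.mpr hle)

end ShadowPath

open ShadowPath in
/-- **The M-convex shadow path bound** (line `lorentzian_shadow`, FIRST RUNG `stub_shadowPath`; the
statement is the line's `ShadowPathBound`, unfolded).  For `D ⊆ Δ(m,K)`, an M-convex `ν : D → ℚ`
(exchange axiom) and pairwise distinct weights `e`, the lower shadow of `{(⟨e,α⟩, ν α) : α ∈ D}` has
at most `m (K - 1) + 1` vertices (strict unique minimisers of `ν + u⟨e,·⟩` for some slope `u`), i.e.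
the tropical `x`-Newton polygon of a split-class / Lorentzian pencil has at most `m (K - 1)` edges.
Proof: the rank potential `Φ β = Σ_i #{k | e k < e i}·β_i ∈ {0,…,(K-1) m}` is injective on shadow
vertices (`ShadowPath.potential_lt_of_rightEnd`). -/
theorem shadowPathBound :
    ∀ (m K : ℕ) (D : Finset (Fin K → ℕ)) (ν : (Fin K → ℕ) → ℚ) (e : Fin K → ℕ),
      D ⊆ (Fintype.piFinset fun _ : Fin K => Finset.range (m + 1)).filter (fun α => ∑ i, α i = m) →
      (∀ α ∈ D, ∀ β ∈ D, ∀ i : Fin K, β i < α i →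
        ∃ j : Fin K, α j < β j ∧ α - Pi.single i 1 + Pi.single j 1 ∈ D ∧
          β - Pi.single j 1 + Pi.single i 1 ∈ D ∧
          ν (α - Pi.single i 1 + Pi.single j 1) + ν (β - Pi.single j 1 + Pi.single i 1)
            ≤ ν α + ν β) →
      Function.Injective e →
        (@Finset.filter (Fin K → ℕ)
          (fun α => α ∈ D ∧ ∃ u : ℚ, ∀ β ∈ D, β ≠ α →
            ν α + u * ((∑ i, e i * α i : ℕ) : ℚ) < ν β + u * ((∑ i, e i * β i : ℕ) : ℚ))
          (fun _ => Classical.propDecidable _) D).card ≤ m * (K - 1) + 1 := by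
  intro m K D ν e hD hν he
  classical
  -- normalise the (classical) decidability instance of the filter to the ambient one
  rw [Finset.filter_congr_decidable]
  -- the rank function
  set r : Fin K → ℕ := fun i => (Finset.univ.filter (fun k => e k < e i)).card with hr_def
  have hr : ∀ i j, e i < e j → r i < r j := by
    intro i j hij
    simp only [hr_def]
    apply Finset.card_lt_card
    rw [Finset.ssubset_iff_subset_ne]
    refine ⟨fun k hk => ?_, fun h => ?_⟩
    · rw [Finset.mem_filter] at hk ⊢
      exact ⟨hk.1, hk.2.trans hij⟩
    · have hi : i ∈ Finset.univ.filter (fun k => e k < e j) :=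
        Finset.mem_filter.mpr ⟨mem_univ _, hij⟩
      rw [← h, Finset.mem_filter] at hi
      exact lt_irrefl _ hi.2
  have hrK : ∀ i, r i ≤ K - 1 := by
    intro i
    simp only [hr_def]
    have hsub : Finset.univ.filter (fun k => e k < e i) ⊆ Finset.univ.erase i := by
      intro k hk
      rw [Finset.mem_filter] at hk
      exact Finset.mem_erase.mpr ⟨fun h => by rw [h] at hk; exact lt_irrefl _ hk.2, mem_univ _⟩
    have := Finset.card_le_card hsub
    rwa [Finset.card_erase_of_mem (mem_univ i), Finset.card_univ, Fintype.card_fin] at this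
  have hDm : ∀ β ∈ D, ∑ k, β k = m := fun β hβ => (Finset.mem_filter.mp (hD hβ)).2
  -- the potential maps shadow vertices injectively into `{0, …, m (K-1)}`
  have key := potential_lt_of_rightEnd D ν e r m hDm hν he hr
  refine (Finset.card_le_card_of_injOn (t := Finset.range (m * (K - 1) + 1))
    (fun β => ∑ k, r k * β k) ?_ ?_).trans (by simp)
  · intro β hβ
    have hβD : β ∈ D := (Finset.mem_filter.mp (Finset.mem_coe.mp hβ)).1
    have h1 : ∑ k, r k * β k ≤ ∑ k, (K - 1) * β k :=
      Finset.sum_le_sum fun k _ => Nat.mul_le_mul_right (β k) (hrK k)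
    rw [← Finset.mul_sum, hDm β hβD] at h1
    show ∑ k, r k * β k ∈ (Finset.range (m * (K - 1) + 1) : Finset ℕ)
    rw [Finset.mem_range, Nat.mul_comm]
    omega
  · intro β₁ hβ₁ β₂ hβ₂ hΦ
    obtain ⟨hβ₁D, -, u₁, hu₁⟩ := Finset.mem_filter.mp (Finset.mem_coe.mp hβ₁)
    obtain ⟨hβ₂D, -, u₂, hu₂⟩ := Finset.mem_filter.mp (Finset.mem_coe.mp hβ₂)
    by_contra hne
    obtain ⟨min₁, right₁⟩ := rightEnd_of_strict D ν e β₁ u₁ hu₁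
    obtain ⟨min₂, right₂⟩ := rightEnd_of_strict D ν e β₂ u₂ hu₂
    -- distinct vertices have distinct weights
    have hs₁ := hu₁ β₂ hβ₂D (Ne.symm hne)
    have hs₂ := hu₂ β₁ hβ₁D hne
    rcases lt_trichotomy (∑ k, e k * β₁ k) (∑ k, e k * β₂ k) with hlt | heq | hgt
    · have := key _ β₂ hβ₂D β₁ hβ₁D u₂ u₁ min₂ right₂ min₁ hlt le_rfl
      simp only at hΦ; omega
    · have heq' : ((∑ k, e k * β₁ k : ℕ) : ℚ) = ((∑ k, e k * β₂ k : ℕ) : ℚ) := by exact_mod_cast heq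
      rw [heq'] at hs₁ hs₂
      linarith
    · have := key _ β₁ hβ₁D β₂ hβ₂D u₁ u₂ min₁ right₁ min₂ hgt le_rfl
      simp only at hΦ; omega

end Summit.ValiantsHypothesis.ValiantsHypothesis.Theorems.LacunarySymmetroidMatrixDescartes
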